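import Summits.CriticalPhenomena.PercolationContinuityZ3.Theorems.PercNearOneGluingNoHeavyLowerTailSahiCombShapeCheck

/-!
# The comb (tensor-Bernstein) hierarchy for Sahi's `E_k`, XIII: computational cells of the typed shape laws — ENDMIN / ORDER-1 / UNI at
# `(n, m) = (3, 3), (4, 2), (5, 2)` (compiled evaluation of the digit scan, `native_decide`)

Support file of the one-cut programme (crux `NoHeavyLowerTail`, stmt-CriticalPhenomena-4575; cell `prim-masterthm`, seat P5), COMPUTATIONAL
(`native_decide`, like prim-l12 P5's `…SahiCubeFourResidualFive*`).  The digit scan `SahiComb.checkShapeCube` of `…SahiCombShapeCheck`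
evaluated by compiled code on three cells — all ordered `n`-tuples of increasing bitmasks: `(3,3)`: `20³ = 8 000` triples of the cube
(base `2^13`), `(4,2)`: `6⁴ = 1 296` quadruples of the square (base `2^14`), `(5,2)`: `6⁵ = 7 776` quintuples of the square (base `2^18`) —
and turned into the laws by `shape_of_checkShapeCube`:

* `combShape_three_fin_three` — ENDMIN(3), ORDER-1(3), UNI(3) for every triple of increasing events of `2^{Fin 3}`;
* `combShape_four_fin_two` — ENDMIN(4), ORDER-1(4), **UNI(4)** (the first law with content beyond ORDER-1) for every quadruple of
  increasing events of `2^{Fin 2}`;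
* `combShape_five_fin_two` — ENDMIN(5), ORDER-1(5), UNI(5) for every quintuple of increasing events of `2^{Fin 2}`.
The kernel (`decide`) cell `(3,2)` is `…SahiCombShapeCells`.  No `sorry`; axioms standard plus `Lean.ofReduceBool` (compiled evaluation).
[this work]
-/

namespace Summit.CriticalPhenomena.PercolationContinuityZ3.Theorems

open SahiComb SahiC3Cube NCopyCert OneCutCert

/-- The shape scan passes on `(n, m) = (3, 3)` (8 000 ordered triples, base `2^13`), compiled evaluation. [this work] -/
theorem SahiComb.checkShapeCube_three_three :
    checkShapeCube 13 3 3 (fun T => (krTB 13 4 3 T : ℤ)) (krTB 13 4 3 (fullN 3)) (maskN 13 (4 ^ 3)) = true := by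
  native_decide

/-- The shape scan passes on `(n, m) = (4, 2)` (1 296 ordered quadruples, base `2^14`), compiled evaluation. [this work] -/
theorem SahiComb.checkShapeCube_four_two :
    checkShapeCube 14 2 4 (fun T => (krTB 14 5 2 T : ℤ)) (krTB 14 5 2 (fullN 2)) (maskN 14 (5 ^ 2)) = true := by
  native_decide

/-- The shape scan passes on `(n, m) = (5, 2)` (7 776 ordered quintuples, base `2^18`), compiled evaluation. [this work] -/
theorem SahiComb.checkShapeCube_five_two :
    checkShapeCube 18 2 5 (fun T => (krTB 18 6 2 T : ℤ)) (krTB 18 6 2 (fullN 2)) (maskN 18 (6 ^ 2)) = true := by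
  native_decide

/-- **ENDMIN(3), ORDER-1(3), UNI(3) on the cube `{0,1}^3`** (computational). [this work] -/
theorem combShape_three_fin_three (U : Fin 3 → Set (Set (Fin 3))) (hU : ∀ i, IsUpperSet (U i)) (e : Fin 3) (j : Fin 3 → ℕ) :
    (∀ t, t ≤ 3 → min (combLine 3 U e j 0) (combLine 3 U e j 3) ≤ combLine 3 U e j t) ∧
      (combLine 3 U e j 0 ≤ combLine 3 U e j 1 ∧ combLine 3 U e j 3 ≤ combLine 3 U e j (3 - 1)) ∧
      ∃ mo, mo ≤ 3 ∧ MonotoneOn (combLine 3 U e j) (Set.Icc 0 mo) ∧ AntitoneOn (combLine 3 U e j) (Set.Icc mo 3) :=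
  shape_of_checkShapeCube (σ := 13) (by norm_num) (by decide) (fun _ => rfl) checkShapeCube_three_three (by norm_num) U hU e j

/-- **ENDMIN(4), ORDER-1(4), UNI(4) on the square `{0,1}^2`** (computational). [this work] -/
theorem combShape_four_fin_two (U : Fin 4 → Set (Set (Fin 2))) (hU : ∀ i, IsUpperSet (U i)) (e : Fin 2) (j : Fin 2 → ℕ) :
    (∀ t, t ≤ 4 → min (combLine 4 U e j 0) (combLine 4 U e j 4) ≤ combLine 4 U e j t) ∧
      (combLine 4 U e j 0 ≤ combLine 4 U e j 1 ∧ combLine 4 U e j 4 ≤ combLine 4 U e j (4 - 1)) ∧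
      ∃ mo, mo ≤ 4 ∧ MonotoneOn (combLine 4 U e j) (Set.Icc 0 mo) ∧ AntitoneOn (combLine 4 U e j) (Set.Icc mo 4) :=
  shape_of_checkShapeCube (σ := 14) (by norm_num) (by decide) (fun _ => rfl) checkShapeCube_four_two (by norm_num) U hU e j

/-- **ENDMIN(5), ORDER-1(5), UNI(5) on the square `{0,1}^2`** (computational). [this work] -/
theorem combShape_five_fin_two (U : Fin 5 → Set (Set (Fin 2))) (hU : ∀ i, IsUpperSet (U i)) (e : Fin 2) (j : Fin 2 → ℕ) :
    (∀ t, t ≤ 5 → min (combLine 5 U e j 0) (combLine 5 U e j 5) ≤ combLine 5 U e j t) ∧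
      (combLine 5 U e j 0 ≤ combLine 5 U e j 1 ∧ combLine 5 U e j 5 ≤ combLine 5 U e j (5 - 1)) ∧
      ∃ mo, mo ≤ 5 ∧ MonotoneOn (combLine 5 U e j) (Set.Icc 0 mo) ∧ AntitoneOn (combLine 5 U e j) (Set.Icc mo 5) :=
  shape_of_checkShapeCube (σ := 18) (by norm_num) (by decide) (fun _ => rfl) checkShapeCube_five_two (by norm_num) U hU e j

end Summit.CriticalPhenomena.PercolationContinuityZ3.Theorems
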